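import Literature.Topology.FourManifolds.EuclideanRegularDomain

/-!
# Hessians and Morse indices on the compact domain `{F ≤ 0} ⊂ ℝ^{m+1}` at interior points

Topic `Literature/Topology/FourManifolds` (fact seat
`provefact-Literature.Geometry.Riemannian.LawsonMichelsohn1984_surrounding`; companion of
`EuclideanRegularDomainCritical.lean`).  Everything here is **proved**; no named facts.

For `h : IsRegularCompactDomain F` (`EuclideanRegularDomain.lean`) and a smooth `Φ` on
`ℝ^{m+1}`, at a point `p` of the domain with `F p < 0` the half-slice chart is the extended chart
of the (boundaryless) synonym `HalfSpaceCharted ℝ^{m+1}`, so the Hessian of `Φ ∘ incl` at `p` is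
the Hessian of `Φ` read on the synonym (`mhessian_comp_incl_eq`; the pattern of
`RegularSublevelAmbient.lean` §3 / `RegularSlabTransfer.lean`), which at a critical point is
congruent to the Euclidean second derivative `D²Φ(incl p)` (`ClosedAsCobordism.lean`,
`HalfSpaceCharted.morseIndex_eq'`).  Hence **the Morse index of `Φ ∘ incl` at an interior
critical point is the negative index of inertia of `D²Φ`** (`morseIndex_comp_incl_eq_sigNeg`)
and **nondegeneracy transfers** (`nondegenerate_mhessian_comp_incl_iff`) — the form in which
the Morse data of a Morse function on the cobordism `(D; ∅, N)` are read on its Seeley extension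
to `ℝ^{m+1}` (Milnor, *Morse theory* (1963), Thm. 3.1 and §3: the critical points of `f|Mᵃ`
below `a` are those of `f`, with the same indices).

## References

* J. Milnor, *Morse theory*, Ann. of Math. Studies 51 (1963), §2, Thm. 3.1. [Milnor1963]
* J. Milnor, *Lectures on the h-cobordism theorem* (1965), Lemma 2.9. [MilnorHCobordism1965]
-/

noncomputable section

open scoped Manifold ContDiff Topology
open Set Function

namespace Literature.Topology.FourManifolds

namespace IsRegularCompactDomain

open HalfSpaceCharted

variable {m : ℕ} {F : EuclideanSpace ℝ (Fin (m + 1)) → ℝ}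

/-- On the model vector space the Hessian of `mhessian` is the second Fréchet derivative
(`MorseBirthLemma.mhessian_model_apply`, repeated to keep the imports light). [folklore] -/
theorem mhessian_self_apply (Φ : EuclideanSpace ℝ (Fin (m + 1)) → ℝ)
    (x v w : EuclideanSpace ℝ (Fin (m + 1))) :
    mhessian (𝓡 (m + 1)) Φ x v w = fderiv ℝ (fderiv ℝ Φ) x v w := by
  simp only [mhessian, writtenInExtChartAt_model_space, ModelWithCorners.range_eq_univ,
    fderivWithin_univ, extChartAt_model_space_eq_id, PartialEquiv.refl_coe, id_eq,
    LinearMap.comp_apply, ContinuousLinearMap.coe_coe]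
  rfl

/-- **The Morse index on the model vector space is the negative index of inertia of `D²Φ`.**
[cite: Milnor1963, §2] -/
theorem morseIndex_self_eq_sigNeg (Φ : EuclideanSpace ℝ (Fin (m + 1)) → ℝ)
    (x : EuclideanSpace ℝ (Fin (m + 1))) :
    morseIndex (𝓡 (m + 1)) Φ x =
      sigNeg ((fderiv ℝ (fderiv ℝ Φ) x).toBilinForm).toQuadraticMap := by
  unfold morseIndex
  exact sigNeg_eq_of_forall_apply_eq (LinearEquiv.refl ℝ _) fun v w => by
    rw [mhessian_self_apply, ContinuousLinearMap.toBilinForm_apply]; rfl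

/-- **The Hessian of the restriction at an interior point is the Hessian on the synonym**
(there the half-slice chart of the domain is the extended chart of `HalfSpaceCharted ℝ^{m+1}`).
[cite: MilnorHCobordism1965, Lemma 2.9] -/
theorem mhessian_comp_incl_eq (h : IsRegularCompactDomain F)
    (Φ : EuclideanSpace ℝ (Fin (m + 1)) → ℝ) (p : h.Domain) (hp : F (Domain.incl h p) < 0) :
    mhessian (𝓡∂ (m + 1)) (Φ ∘ Domain.incl h) p =
      mhessian (𝓡∂ (m + 1)) (Φ ∘ (of (X := EuclideanSpace ℝ (Fin (m + 1)))).symm) p.1 := by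
  set Φ' : HalfSpaceCharted (EuclideanSpace ℝ (Fin (m + 1))) → ℝ :=
    Φ ∘ (of (X := EuclideanSpace ℝ (Fin (m + 1)))).symm with hΦ'
  have hlt : (F ∘ (of (X := EuclideanSpace ℝ (Fin (m + 1)))).symm) p.1 < 0 := hp
  have hD : h.atlas.datum p = sublevelChartLT _ 0 h.contMDiff_comp_symm.continuous p.1 :=
    sublevelAtlas_datum_of_lt _ _ _ _ p hlt
  have hint : (𝓡∂ (m + 1)).IsInteriorPoint p.1 := isInteriorPoint_halfSpaceCharted p.1
  have h0 : 0 < (h.atlas.datum p).Θ p.1 0 := by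
    rw [hD, sublevelChartLT_apply]
    rw [ModelWithCorners.IsInteriorPoint, interior_range_modelWithCornersEuclideanHalfSpace] at hint
    exact hint
  have hF' : (Φ' ∘ (h.atlas.datum p).Θ.symm) =ᶠ[𝓝 ((h.atlas.datum p).Θ p.1)]
      fun z => writtenInExtChartAt (𝓡∂ (m + 1)) 𝓘(ℝ, ℝ) p.1 Φ' z + 0 := by
    refine Filter.Eventually.of_forall fun z => ?_
    rw [hD]
    simp [writtenInExtChartAt]
  have key : mhessian (𝓡∂ (m + 1)) (Φ ∘ Domain.incl h) p = (ContinuousLinearMap.coeLM ℝ).comp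
      (fderivWithin ℝ (fderivWithin ℝ (writtenInExtChartAt (𝓡∂ (m + 1)) 𝓘(ℝ, ℝ) p.1 Φ')
        (range (𝓡∂ (m + 1)))) (range (𝓡∂ (m + 1))) ((h.atlas.datum p).Θ p.1)).toLinearMap :=
    h.atlas.mhessian_comp_val_eq Φ' p h0 hF'
  rw [key, mhessian, hD, sublevelChartLT_apply]

/-- **The Morse index of the restriction at an interior critical point is the negative index
of inertia of the Euclidean second derivative.** [cite: Milnor1963, Thm. 3.1 and §3] -/
theorem morseIndex_comp_incl_eq_sigNeg (h : IsRegularCompactDomain F)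
    {Φ : EuclideanSpace ℝ (Fin (m + 1)) → ℝ} (hΦ : ContDiff ℝ 2 Φ) (p : h.Domain)
    (hp : F (Domain.incl h p) < 0) (hcrit : fderiv ℝ Φ (Domain.incl h p) = 0) :
    morseIndex (𝓡∂ (m + 1)) (Φ ∘ Domain.incl h) p =
      sigNeg ((fderiv ℝ (fderiv ℝ Φ) (Domain.incl h p)).toBilinForm).toQuadraticMap := by
  have h1 : morseIndex (𝓡∂ (m + 1)) (Φ ∘ Domain.incl h) p =
      morseIndex (𝓡∂ (m + 1)) (Φ ∘ (of (X := EuclideanSpace ℝ (Fin (m + 1)))).symm) p.1 := by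
    rw [morseIndex, mhessian_comp_incl_eq h Φ p hp, morseIndex]
  have hc : ContMDiffAt (𝓡 (m + 1)) 𝓘(ℝ, ℝ) 2 Φ (of.symm p.1) := hΦ.contMDiff.contMDiffAt
  have hq : IsMCriticalPt (𝓡 (m + 1)) Φ (of.symm p.1) := by
    show mfderiv (𝓡 (m + 1)) 𝓘(ℝ, ℝ) Φ (of.symm p.1) = 0
    rw [_root_.mfderiv_eq_fderiv]
    exact hcrit
  rw [h1, HalfSpaceCharted.morseIndex_eq' hc hq, morseIndex_self_eq_sigNeg]
  rfl

/-- **Nondegeneracy of the Hessian of the restriction at an interior critical point gives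
nondegeneracy of the Euclidean second derivative** (in the left-separating form used by the
Euclidean Morse lemma `exists_openPartialHomeomorph_comp_symm_eq_sum_sq`).
[cite: Milnor1963, Thm. 3.1 and §3] -/
theorem forall_fderiv_fderiv_eq_zero_of_nondegenerate (h : IsRegularCompactDomain F)
    {Φ : EuclideanSpace ℝ (Fin (m + 1)) → ℝ} (hΦ : ContDiff ℝ 2 Φ) (p : h.Domain)
    (hp : F (Domain.incl h p) < 0) (hcrit : fderiv ℝ Φ (Domain.incl h p) = 0)
    (hnd : (mhessian (𝓡∂ (m + 1)) (Φ ∘ Domain.incl h) p).Nondegenerate) :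
    ∀ u, (∀ v, fderiv ℝ (fderiv ℝ Φ) (Domain.incl h p) u v = 0) → u = 0 := by
  have hc : ContMDiffAt (𝓡 (m + 1)) 𝓘(ℝ, ℝ) 2 Φ (of.symm p.1) := hΦ.contMDiff.contMDiffAt
  have hq : IsMCriticalPt (𝓡 (m + 1)) Φ (of.symm p.1) := by
    show mfderiv (𝓡 (m + 1)) 𝓘(ℝ, ℝ) Φ (of.symm p.1) = 0
    rw [_root_.mfderiv_eq_fderiv]
    exact hcrit
  rw [mhessian_comp_incl_eq h Φ p hp] at hnd
  have h2 := HalfSpaceCharted.nondegenerate_mhessian_iff hc hq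
  have hp1 : of (of.symm p.1) = p.1 := of.apply_symm_apply p.1
  rw [hp1] at h2
  rw [h2] at hnd
  intro u hu
  refine hnd.1 u fun v => ?_
  rw [mhessian_self_apply]
  exact hu v

end IsRegularCompactDomain

end Literature.Topology.FourManifolds

end
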